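import Summits.BirchSwinnertonDyer.BirchSwinnertonDyer.Theorems.PrintCFramBottomClassIndexLawFiveLeHerbrandRationalTransport
import Literature.NumberTheory.GaloisRepresentations.ModNCyclotomicCharacter
import Mathlib.NumberTheory.NumberField.CMField

/-!
# Road C, stub D (Galois half), file 2: the subgroups `N = ker r ⊓ range res_{ℚ,K}`, `N′ = N ⊓ ker χ̄_p` and the fields
# `L = ℚ̄^N`, `L′ = ℚ̄^{N′} ∋ ζ_p` (finite ABELIAN over `ℚ`, `p ∤ [L′:ℚ]`, `L′` CM)

Summit `BirchSwinnertonDyer`, crux `PrintCFram.BottomClassIndexLawFiveLe` (stmt-BirchSwinnertonDyer-20372), line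
`eisenstein-resource-bdp-line`, Stub H′; width seat `bsd-line-cfram-p1-w4` g5, typing item «D-gal» of LEAD g9's ROAD C (sequel of
`…HerbrandRationalTransport.lean`).  HONEST FRAMING: Galois bookkeeping only; no summit statement is proved here, no stub is closed.

LEAD g9 (STATUS 18:01Z): «INTENDED INSTANCES: N = range(res_{ℚ,L}) for L = K''(θ) abelian, p ∤ [L:ℚ], r₁ the ODD lift (trivial on N);
N′ = range(res_{ℚ,L′}), L′ = L(μ_p) CM abelian, r₂ the EVEN lift … N′ ≤ N of index prime to p (N^k ⊆ N′)».  This file supplies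
these objects from the data `r : Γ_ℚ →* (ZMod p)ˣ` (open kernel), `K/ℚ` finite Galois with abelian group and `p ∤ [K:ℚ]`, and the
mod-`p` cyclotomic character `χ̄_p = modNCyclotomicCharacter ℚ p`:

* §1 subgroups: `isOpen_ker_modNCyclotomicCharacter'` (any field), `pow_sub_one_mem_inf_ker` (`n ∈ N ⟹ n^{p-1} ∈ N ⊓ ker χ` for any
  `χ : Γ →* (ZMod p)ˣ`), `not_dvd_sub_one`, `index_inf_dvd_of_normal` (`[Γ : H ⊓ K] ∣ [Γ:H]·[Γ:K]`, `H` normal), `index_ker_dvd_card`,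
  **`not_dvd_index_ker_inf_range_inf_ker`** (`p ∤ [Γ_ℚ : ker r ⊓ range res_{ℚ,K} ⊓ ker χ̄_p]` when `p ∤ [K:ℚ]`), **`not_dvd_index_ker_inf_range`**,
  **`commutator_mem_ker_inf_range_inf_ker`** / `commutator_mem_ker_inf_range` (commutators of `Γ_ℚ` lie in `N′`, `N` when `Gal(K/ℚ)` is
  abelian), `isOpen_normal_ker_inf_range_inf_ker`.
* §2 fields of open normal subgroups `N ≤ Γ_F` (any `F` of characteristic `0`): **`isAbelianGalois_fixedField_of_commutator_mem`**;
  **`exists_isPrimitiveRoot_fixedField_of_le_ker`** (`N ≤ ker χ̄_p ⟹ ζ_p ∈ F̄^N`); `exists_apply_eq_pow` (`σ ζ = ζ^{a σ}` for some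
  `a : Gal(E/F) → ℕ`); **`natCast_exponent_absGaloisQuot_eq`** (`(a τ̄ : ZMod p) = χ̄_p τ` for EVERY such `a` — w8 g0's `ha`/avatar link);
  **`isTotallyComplex_of_isPrimitiveRoot`** (`ζ_p ∈ E`, `p` odd ⟹ `E` totally complex); **`isCMField_fixedField`** (abelian + `ζ_p` ⟹ CM);
  `finrank_fixedField_eq_index` / **`not_dvd_finrank_fixedField`**.

References: J. Neukirch, *Algebraic Number Theory*, Ch. IV §1 [NeukirchANT1999]; L. Washington, *Cyclotomic Fields*, §§1–2;
the LEAD g9 STATUS lines of 2026-08-28 (Road C plan).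
-/

noncomputable section

-- summit-side namespace `Summit.BirchSwinnertonDyer.BirchSwinnertonDyer.…` (single-conjunct summit, D-0017 layout)
set_option linter.dupNamespace false
set_option autoImplicit false

open scoped Classical Pointwise
open NumberField IsDedekindDomain Field
open Literature.NumberTheory.GaloisRepresentations

namespace Summit.BirchSwinnertonDyer.BirchSwinnertonDyer.Theorems.PrintCFram.HerbrandSelmerToHom

/-! ### §1 The subgroups -/

section Subgroups

/-- The mod-`N` cyclotomic character of any field has open kernel. [folklore] -/
theorem isOpen_ker_modNCyclotomicCharacter' (F : Type*) [Field F] (N : ℕ) [NeZero N] [NeZero (N : F)] :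
    IsOpen (((modNCyclotomicCharacter F N).ker : Subgroup (absoluteGaloisGroup F)) : Set (absoluteGaloisGroup F)) :=
  Subgroup.isOpen_of_mem_nhds _ (modNCyclotomicCharacter_eventually_eq_one F N)

variable {Γ : Type*} [Group Γ] {p : ℕ}

/-- `n ∈ N ⟹ n^{p-1} ∈ N ⊓ ker χ` for a character `χ : Γ → (ℤ/p)ˣ` (`|(ℤ/p)ˣ| = p - 1`). [folklore] -/
theorem pow_sub_one_mem_inf_ker [Fact p.Prime] (N : Subgroup Γ) (χ : Γ →* (ZMod p)ˣ) {n : Γ} (hn : n ∈ N) :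
    n ^ (p - 1) ∈ N ⊓ χ.ker :=
  Subgroup.mem_inf.mpr ⟨N.pow_mem hn _, by rw [MonoidHom.mem_ker, map_pow, ZMod.units_pow_card_sub_one_eq_one]⟩

omit [Group Γ] in
/-- `p ∤ p - 1` for a prime `p`. [folklore] -/
theorem not_dvd_sub_one (hp : p.Prime) : ¬ p ∣ p - 1 :=
  Nat.not_dvd_of_pos_of_lt (Nat.sub_pos_of_lt hp.one_lt) (Nat.sub_lt hp.pos Nat.one_pos)

/-- `[Γ : H ⊓ K] ∣ [Γ : H] · [Γ : K]` for `H` normal. [folklore] -/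
theorem index_inf_dvd_of_normal (H K : Subgroup Γ) [H.Normal] : (H ⊓ K).index ∣ H.index * K.index := by
  rw [← Subgroup.relIndex_mul_index (inf_le_right : H ⊓ K ≤ K), Subgroup.inf_relIndex_right]
  exact Nat.mul_dvd_mul_right (Subgroup.relIndex_dvd_index_of_normal H K) _

/-- `[Γ : ker r] ∣ |A|` for `r : Γ → A`. [folklore] -/
theorem index_ker_dvd_card {A : Type*} [Group A] (r : Γ →* A) : r.ker.index ∣ Nat.card A := by
  rw [Subgroup.index_ker]
  exact Subgroup.card_subgroup_dvd_card r.range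

omit [Group Γ] in
/-- `|(ℤ/p)ˣ| = p - 1`. [folklore] -/
theorem natCard_units_zmod [Fact p.Prime] : Nat.card (ZMod p)ˣ = p - 1 := by
  rw [Nat.card_eq_fintype_card, ZMod.card_units]

variable {K : Type} [Field K] [NumberField K] [IsGalois ℚ K]

/-- **`p ∤ [Γ_ℚ : ker r ⊓ range res_{ℚ,K}]`** for `r : Γ_ℚ → (ℤ/p)ˣ` and `p ∤ [K:ℚ]`. [folklore] -/
theorem not_dvd_index_ker_inf_range [Fact p.Prime] (r : absoluteGaloisGroup ℚ →* (ZMod p)ˣ) (hpK : ¬ p ∣ Module.finrank ℚ K) :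
    ¬ p ∣ (r.ker ⊓ (absGaloisRestrict ℚ K).range).index := by
  have hp : p.Prime := Fact.out
  haveI : FiniteDimensional ℚ K := Module.Finite.of_restrictScalars_finite ℚ ℚ K
  intro h
  have h1 := h.trans (index_inf_dvd_of_normal r.ker _)
  rw [SorensenPatching.index_range_absGaloisRestrict] at h1
  rcases (Nat.Prime.dvd_mul hp).mp h1 with h2 | h2
  · exact not_dvd_sub_one hp ((h2.trans (index_ker_dvd_card r)).trans (natCard_units_zmod (p := p)).dvd)
  · exact hpK h2

/-- **`p ∤ [Γ_ℚ : ker r ⊓ range res_{ℚ,K} ⊓ ker χ̄_p]`** (`p ∤ [K:ℚ]`). [folklore] -/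
theorem not_dvd_index_ker_inf_range_inf_ker [Fact p.Prime] (r : absoluteGaloisGroup ℚ →* (ZMod p)ˣ)
    (hpK : ¬ p ∣ Module.finrank ℚ K) :
    ¬ p ∣ (r.ker ⊓ (absGaloisRestrict ℚ K).range ⊓ (modNCyclotomicCharacter ℚ p).ker).index := by
  have hp : p.Prime := Fact.out
  intro h
  rw [inf_comm] at h
  have h1 := h.trans (index_inf_dvd_of_normal (modNCyclotomicCharacter ℚ p).ker _)
  rcases (Nat.Prime.dvd_mul hp).mp h1 with h2 | h2
  · exact not_dvd_sub_one hp ((h2.trans (index_ker_dvd_card _)).trans (natCard_units_zmod (p := p)).dvd)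
  · exact not_dvd_index_ker_inf_range r hpK h2

/-- Commutators of `Γ_ℚ` restrict trivially to an ABELIAN `K/ℚ`: `γδγ⁻¹δ⁻¹ ∈ range res_{ℚ,K}`. [folklore] -/
theorem commutator_mem_range [IsMulCommutative (K ≃ₐ[ℚ] K)] (γ δ : absoluteGaloisGroup ℚ) :
    γ * δ * γ⁻¹ * δ⁻¹ ∈ (absGaloisRestrict ℚ K).range := by
  rw [← absGaloisQuot_eq_one_iff, map_mul, map_mul, map_mul, map_inv, map_inv, mul_inv_eq_one, mul_inv_eq_iff_eq_mul]
  exact (IsMulCommutative.is_comm.comm _ _)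

omit [NumberField K] [IsGalois ℚ K] in
/-- Commutators lie in the kernel of a character. [folklore] -/
theorem commutator_mem_ker {A : Type*} [CommGroup A] (r : absoluteGaloisGroup ℚ →* A) (γ δ : absoluteGaloisGroup ℚ) :
    γ * δ * γ⁻¹ * δ⁻¹ ∈ r.ker := by
  rw [MonoidHom.mem_ker, map_mul, map_mul, map_mul, map_inv, map_inv, mul_inv_eq_one, mul_inv_eq_iff_eq_mul, mul_comm]

/-- Commutators of `Γ_ℚ` lie in `N = ker r ⊓ range res_{ℚ,K}` (`K/ℚ` abelian). [folklore] -/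
theorem commutator_mem_ker_inf_range [IsMulCommutative (K ≃ₐ[ℚ] K)] {A : Type*} [CommGroup A]
    (r : absoluteGaloisGroup ℚ →* A) (γ δ : absoluteGaloisGroup ℚ) :
    γ * δ * γ⁻¹ * δ⁻¹ ∈ r.ker ⊓ (absGaloisRestrict ℚ K).range :=
  ⟨commutator_mem_ker r γ δ, commutator_mem_range γ δ⟩

/-- Commutators of `Γ_ℚ` lie in `N′ = ker r ⊓ range res_{ℚ,K} ⊓ ker χ̄_p` (`K/ℚ` abelian). [folklore] -/
theorem commutator_mem_ker_inf_range_inf_ker [IsMulCommutative (K ≃ₐ[ℚ] K)] [NeZero p] {A : Type*} [CommGroup A]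
    (r : absoluteGaloisGroup ℚ →* A) (γ δ : absoluteGaloisGroup ℚ) :
    γ * δ * γ⁻¹ * δ⁻¹ ∈ r.ker ⊓ (absGaloisRestrict ℚ K).range ⊓ (modNCyclotomicCharacter ℚ p).ker :=
  ⟨commutator_mem_ker_inf_range r γ δ, commutator_mem_ker _ γ δ⟩

/-- `N′ = ker r ⊓ range res_{ℚ,K} ⊓ ker χ̄_p` is open and normal (`ker r` open). [folklore] -/
theorem isOpen_normal_ker_inf_range_inf_ker [NeZero p] {A : Type*} [CommGroup A] (r : absoluteGaloisGroup ℚ →* A)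
    (hr : IsOpen (r.ker : Set (absoluteGaloisGroup ℚ))) :
    IsOpen ((r.ker ⊓ (absGaloisRestrict ℚ K).range ⊓ (modNCyclotomicCharacter ℚ p).ker :
        Subgroup (absoluteGaloisGroup ℚ)) : Set (absoluteGaloisGroup ℚ)) ∧
      (r.ker ⊓ (absGaloisRestrict ℚ K).range ⊓ (modNCyclotomicCharacter ℚ p).ker).Normal := by
  haveI : FiniteDimensional ℚ K := Module.Finite.of_restrictScalars_finite ℚ ℚ K
  obtain ⟨ho, hn⟩ := isOpen_normal_ker_inf_range (L := K) r hr
  haveI := hn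
  refine ⟨?_, inferInstance⟩
  rw [Subgroup.coe_inf]
  exact ho.inter (isOpen_ker_modNCyclotomicCharacter' ℚ p)

end Subgroups

/-! ### §2 The fields of open normal subgroups -/

section Fields

variable {F : Type} [Field F] [CharZero F]

/-- **`F̄^N / F` is ABELIAN when `N` (open, normal) contains all commutators of `Γ_F`.** [cite: NeukirchANT1999, Ch. IV §1] -/
theorem isAbelianGalois_fixedField_of_commutator_mem (N : Subgroup (absoluteGaloisGroup F)) [hn : N.Normal]
    (hN : IsOpen (N : Set (absoluteGaloisGroup F))) (hcomm : ∀ γ δ : absoluteGaloisGroup F, γ * δ * γ⁻¹ * δ⁻¹ ∈ N) :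
    IsAbelianGalois F (IntermediateField.fixedField N : IntermediateField F (AlgebraicClosure F)) := by
  set E : IntermediateField F (AlgebraicClosure F) := IntermediateField.fixedField N
  have hE : E.fixingSubgroup = N := fixingSubgroup_fixedField_of_isOpen N hN
  haveI : FiniteDimensional F E := finiteDimensional_fixedField_of_isOpen N hN
  haveI : IsGalois F (AlgebraicClosure F) := {}
  haveI hGal : IsGalois F E := IsGalois.of_fixedField_normal_subgroup (hn := hn) N
  haveI : Normal F E := hGal.to_normal
  have hsurj : Function.Surjective (AlgEquiv.restrictNormalHom E : absoluteGaloisGroup F →* (E ≃ₐ[F] E)) :=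
    AlgEquiv.restrictNormalHom_surjective (F := F) (K₁ := E) (AlgebraicClosure F)
  have hker : (AlgEquiv.restrictNormalHom E : absoluteGaloisGroup F →* (E ≃ₐ[F] E)).ker = N := by
    rw [IntermediateField.restrictNormalHom_ker, hE]
  haveI : IsMulCommutative (E ≃ₐ[F] E) := by
    refine ⟨⟨fun a b => ?_⟩⟩
    obtain ⟨σ, rfl⟩ := hsurj a
    obtain ⟨τ, rfl⟩ := hsurj b
    rw [← map_mul, ← map_mul, ← mul_inv_eq_one, ← map_inv, ← map_mul, ← MonoidHom.mem_ker, hker, mul_inv_rev]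
    have h := hcomm σ τ
    rwa [mul_assoc] at h ⊢
  exact IsAbelianGalois.mk

variable {p : ℕ} [Fact p.Prime]

omit [CharZero F] in
/-- **`ζ_p ∈ F̄^N` when `N ≤ ker χ̄_p`.** [folklore] -/
theorem exists_isPrimitiveRoot_fixedField_of_le_ker [NeZero (p : F)] (N : Subgroup (absoluteGaloisGroup F))
    (hle : N ≤ (modNCyclotomicCharacter F p).ker) :
    ∃ ζ : (IntermediateField.fixedField N : IntermediateField F (AlgebraicClosure F)), IsPrimitiveRoot ζ p := by
  obtain ⟨ζ₀, hζ₀⟩ := HasEnoughRootsOfUnity.exists_primitiveRoot (AlgebraicClosure F) p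
  have hmem : ζ₀ ∈ (IntermediateField.fixedField N : IntermediateField F (AlgebraicClosure F)) := by
    rw [IntermediateField.mem_fixedField_iff]
    intro σ hσ
    have h := modNCyclotomicCharacter_spec F p σ ζ₀ hζ₀.pow_eq_one
    rw [show modNCyclotomicCharacter F p σ = 1 from hle hσ, Units.val_one, ZMod.val_one p, pow_one] at h
    exact h
  refine ⟨⟨ζ₀, hmem⟩, ?_⟩
  exact IsPrimitiveRoot.of_map_of_injective (f := (algebraMap (IntermediateField.fixedField N) (AlgebraicClosure F)))
    (by exact hζ₀) (FaithfulSMul.algebraMap_injective _ _)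

omit [CharZero F] [Fact p.Prime] in
/-- Every `F`-automorphism of a field `E ∋ ζ_p` acts on `ζ_p` by a power: `σ ζ = ζ^{a σ}`. [folklore] -/
theorem exists_apply_eq_pow [NeZero p] {E : Type*} [Field E] [Algebra F E] {ζ : E} (hζ : IsPrimitiveRoot ζ p) :
    ∃ a : (E ≃ₐ[F] E) → ℕ, ∀ σ : E ≃ₐ[F] E, σ ζ = ζ ^ a σ := by
  have h : ∀ σ : E ≃ₐ[F] E, ∃ i : ℕ, ζ ^ i = σ ζ := fun σ => by
    obtain ⟨i, -, hi⟩ := hζ.eq_pow_of_pow_eq_one (ξ := σ ζ) (by rw [← map_pow, hζ.pow_eq_one, map_one])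
    exact ⟨i, hi⟩
  choose a ha using h
  exact ⟨a, fun σ => (ha σ).symm⟩

omit [CharZero F] in
/-- **The exponent IS the cyclotomic character: `(a τ̄ : ZMod p) = χ̄_p τ`** for `E/F` normal inside `F̄`-currency (`τ̄ = absGaloisQuot F E τ`),
ANY `ζ_p ∈ E` primitive and ANY exponent function `a` with `σ ζ = ζ^{a σ}` (w8 g0's `ha` hypothesis, linked to `χ̄_p`). [folklore] -/
theorem natCast_exponent_absGaloisQuot_eq [NeZero (p : F)] {E : Type*} [Field E] [Algebra F E] [Normal F E]
    {ζ : E} (hζ : IsPrimitiveRoot ζ p) (a : (E ≃ₐ[F] E) → ℕ) (ha : ∀ σ : E ≃ₐ[F] E, σ ζ = ζ ^ a σ) (τ : absoluteGaloisGroup F) :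
    (a (absGaloisQuot F E τ) : ZMod p) = (modNCyclotomicCharacter F p τ : ZMod p) := by
  have he : IsPrimitiveRoot (absEmbedding F E ζ) p := hζ.map_of_injective (absEmbedding F E).injective
  have h1 : absEmbedding F E ζ ^ a (absGaloisQuot F E τ) =
      absEmbedding F E ζ ^ ((modNCyclotomicCharacter F p τ : (ZMod p)ˣ) : ZMod p).val := by
    rw [← map_pow, ← ha, absEmbedding_absGaloisQuot_apply]
    exact modNCyclotomicCharacter_spec F p τ _ he.pow_eq_one
  -- compare exponents in the unit group (a cancellative monoid)
  have hu : IsUnit (absEmbedding F E ζ) := he.isUnit (NeZero.ne p)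
  have h1u : hu.unit ^ a (absGaloisQuot F E τ) = hu.unit ^ ((modNCyclotomicCharacter F p τ : (ZMod p)ˣ) : ZMod p).val := by
    ext
    rw [Units.val_pow_eq_pow_val, Units.val_pow_eq_pow_val, hu.unit_spec]
    exact h1
  have hord : orderOf hu.unit = p := by
    rw [← orderOf_units, hu.unit_spec]
    exact he.eq_orderOf.symm
  have h2 := pow_eq_pow_iff_modEq.mp h1u
  rw [hord] at h2
  rw [← ZMod.natCast_zmod_val ((modNCyclotomicCharacter F p τ : (ZMod p)ˣ) : ZMod p), ZMod.natCast_eq_natCast_iff]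
  exact h2

omit [CharZero F] [Fact p.Prime] in
/-- **A field containing `ζ_p`, `p` odd, is totally complex** (a real embedding would send `ζ_p` to a real `p`-th root of unity, i.e. to `1`).
[folklore] -/
theorem isTotallyComplex_of_isPrimitiveRoot {E : Type*} [Field E] {ζ : E} (hζ : IsPrimitiveRoot ζ p) (hp : Odd p) (hp1 : 1 < p) :
    IsTotallyComplex E := by
  refine ⟨fun w => ?_⟩
  rw [← InfinitePlace.not_isReal_iff_isComplex]
  intro hw
  let φ : E →+* ℝ := InfinitePlace.embedding_of_isReal hw
  have h1 : (φ ζ) ^ p = 1 := by rw [← map_pow, hζ.pow_eq_one, map_one]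
  rcases (pow_eq_one_iff_of_ne_zero (by omega)).mp h1 with h | ⟨-, h⟩
  · exact hζ.ne_one hp1 (φ.injective (by rw [h, map_one]))
  · exact (Nat.not_even_iff_odd.mpr hp) h

omit [CharZero F] [Fact p.Prime] in
/-- **An abelian number field containing `ζ_p` (`p` odd) is a CM field** (totally complex + Mathlib's
`IsCMField.of_isAbelianGalois`). [folklore] -/
theorem isCMField_of_isPrimitiveRoot {E : Type*} [Field E] [NumberField E] [IsAbelianGalois ℚ E] {ζ : E}
    (hζ : IsPrimitiveRoot ζ p) (hp : Odd p) (hp1 : 1 < p) : IsCMField E := by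
  haveI := isTotallyComplex_of_isPrimitiveRoot hζ hp hp1
  exact IsCMField.of_isAbelianGalois E

/-- **`ℚ̄^N` is a CM field** for `N ≤ Γ_ℚ` open normal containing the commutators and contained in `ker χ̄_p`, `p` an odd prime
(all `ℚ`-structures on `ℚ̄^N` agree: `Rat.algebra_rat_subsingleton`). [cite: NeukirchANT1999, Ch. IV §1] -/
theorem isCMField_fixedField (hp2 : p ≠ 2) (N : Subgroup (absoluteGaloisGroup ℚ)) [N.Normal]
    (hN : IsOpen (N : Set (absoluteGaloisGroup ℚ))) (hcomm : ∀ γ δ : absoluteGaloisGroup ℚ, γ * δ * γ⁻¹ * δ⁻¹ ∈ N)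
    (hle : N ≤ (modNCyclotomicCharacter ℚ p).ker) :
    IsCMField (IntermediateField.fixedField N : IntermediateField ℚ (AlgebraicClosure ℚ)) := by
  have hp : p.Prime := Fact.out
  haveI : FiniteDimensional ℚ (IntermediateField.fixedField N : IntermediateField ℚ (AlgebraicClosure ℚ)) :=
    finiteDimensional_fixedField_of_isOpen N hN
  haveI : NumberField (IntermediateField.fixedField N : IntermediateField ℚ (AlgebraicClosure ℚ)) :=
    { to_charZero := inferInstance, to_finiteDimensional := inferInstance }
  have hab := isAbelianGalois_fixedField_of_commutator_mem N hN hcomm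
  -- the two `ℚ`-algebra structures on `ℚ̄^N` (Mathlib's `algebraRat` and the intermediate-field one) coincide
  haveI : @IsAbelianGalois ℚ (IntermediateField.fixedField N : IntermediateField ℚ (AlgebraicClosure ℚ)) _ _
      DivisionRing.toRatAlgebra := by
    have e : (DivisionRing.toRatAlgebra : Algebra ℚ (IntermediateField.fixedField N : IntermediateField ℚ (AlgebraicClosure ℚ))) =
        (IntermediateField.fixedField N).algebra := Subsingleton.elim _ _
    rw [e]
    exact hab
  obtain ⟨ζ, hζ⟩ := exists_isPrimitiveRoot_fixedField_of_le_ker (F := ℚ) N hle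
  exact isCMField_of_isPrimitiveRoot hζ (hp.odd_of_ne_two hp2) hp.one_lt

omit [Fact p.Prime] in
/-- `p ∤ [F̄^N : F]` from `p ∤ [Γ_F : N]` (tree `finrank_fixedField_of_isOpen`). [cite: NeukirchANT1999, Ch. IV §1] -/
theorem not_dvd_finrank_fixedField (N : Subgroup (absoluteGaloisGroup F)) (hN : IsOpen (N : Set (absoluteGaloisGroup F)))
    (hidx : ¬ p ∣ N.index) :
    ¬ p ∣ Module.finrank F (IntermediateField.fixedField N : IntermediateField F (AlgebraicClosure F)) := by
  rwa [finrank_fixedField_of_isOpen N hN]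

end Fields

end Summit.BirchSwinnertonDyer.BirchSwinnertonDyer.Theorems.PrintCFram.HerbrandSelmerToHom

end
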